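import Mathlib
import Summits.MatrixMultiplication.MatrixMultiplication.Theorems.GradedDesignFamily.Negative.GramTraceRank

/-!
# Trace–rank inequality for the frame indicator vectors on `Γ ⊆ GL₂(K)`
# (crux `LevelGradedCohnUmans.GradedDesignFamily`, stmt-MatrixMultiplication-7610; negative side,
# line `quadratic-extension-level-one-cell`, stub `gl2Flat_trace_rank_frame`)

Let `K` be a finite field with `Q := |K|` elements and `Γ ⊆ GL₂(K)` a finite set.  For a flag
`p = (u, w) ∈ K² × K²` let `c_p ∈ ℝ^Γ` be the indicator vector `c_p(x) := [x u = w]`, let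
`ρ := dim_ℝ span {c_p}` and `n(x, y) := #{u ∈ K² : x u = y u}` (`x, y ∈ Γ`).  Then

* `gl2Flat_trace_rank_frame` — `Q⁴ · |Γ|² ≤ ρ · Σ_{x, y ∈ Γ} n(x, y)²`.

This is piece (a) of the flat-size lemma on `GL₂(K)` of the line's negative programme.

Proof: instantiate the Gram trace–rank inequality `sum_sq_sq_le_finrank_mul_sum_gram_sq`
(`(Σ_i ‖v_i‖²)² ≤ dim span{v_i} · Σ_{i,j} ⟨v_i, v_j⟩²`, file `GramTraceRank`) with `ι := K² × K²`,
`P := ↥Γ` and `v p x := [x p.1 = p.2]`, and evaluate the two sides: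
`Σ_p ‖c_p‖² = Σ_{x ∈ Γ} Σ_u Σ_w [x u = w] = Q² |Γ|` (one `w` per `u`), and
`Σ_{p,p'} ⟨c_p, c_{p'}⟩² = Σ_{x,y} (Σ_p c_p(x) c_p(y))² = Σ_{x,y} n(x,y)²` (expand the square, swap the
sums, and `Σ_{(u,w)} [x u = w][y u = w] = #{u : x u = y u}`).

Sorry-free; axioms `propext`, `Classical.choice`, `Quot.sound`.
-/

set_option linter.dupNamespace false

open scoped BigOperators

namespace Summit.MatrixMultiplication.MatrixMultiplication.Theorems.GradedDesignFamily.Negative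

variable {K : Type} [Field K] [Fintype K] [DecidableEq K]

/-- For a fixed matrix `M`, the number of flags `(u, w) ∈ K² × K²` with `M u = w` is `|K|²`
(exactly one `w` for each `u`): `Σ_{(u,w)} [M u = w] = Q²`. -/
private theorem gl2Flat_trace_rank_frame_sum_indicator (M : Matrix (Fin 2) (Fin 2) K) :
    ∑ p : (Fin 2 → K) × (Fin 2 → K), (if M.mulVec p.1 = p.2 then (1 : ℝ) else 0) =
      (Fintype.card K : ℝ) ^ 2 := by
  rw [Fintype.sum_prod_type]
  simp only [Finset.sum_ite_eq, Finset.mem_univ, if_true, Finset.sum_const, Finset.card_univ,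
    Fintype.card_fun, Fintype.card_fin, nsmul_eq_mul, mul_one]
  push_cast
  ring

/-- `Σ_p Σ_{x : ↥Γ} [x p.1 = p.2]² = Q² · |Γ|` (the indicators are `0/1`-valued, swap the sums and
use `gl2Flat_trace_rank_frame_sum_indicator`). -/
private theorem gl2Flat_trace_rank_frame_sum_sq
    (Γ : Finset (Matrix.GeneralLinearGroup (Fin 2) K)) :
    ∑ p : (Fin 2 → K) × (Fin 2 → K), ∑ x : {x // x ∈ Γ},
        (if ((x : Matrix.GeneralLinearGroup (Fin 2) K) : Matrix (Fin 2) (Fin 2) K).mulVec p.1 = p.2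
          then (1 : ℝ) else 0) ^ 2 =
      (Fintype.card K : ℝ) ^ 2 * Γ.card := by
  have hsq : ∀ (c : Prop) [Decidable c],
      (if c then (1 : ℝ) else 0) ^ 2 = if c then (1 : ℝ) else 0 := by
    intro c _
    split_ifs <;> norm_num
  simp_rw [hsq]
  rw [Finset.sum_comm]
  simp_rw [gl2Flat_trace_rank_frame_sum_indicator]
  rw [Finset.sum_const, Finset.card_univ, Fintype.card_coe, nsmul_eq_mul, mul_comm]

/-- `Σ_{(u,w)} [M u = w] · [N u = w] = #{u : M u = N u}` (for fixed `u` the `w`-sum has the single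
term `w = M u`, present iff `N u = M u`). -/
private theorem gl2Flat_trace_rank_frame_gram_entry (M N : Matrix (Fin 2) (Fin 2) K) :
    ∑ p : (Fin 2 → K) × (Fin 2 → K),
        (if M.mulVec p.1 = p.2 then (1 : ℝ) else 0) * (if N.mulVec p.1 = p.2 then (1 : ℝ) else 0) =
      ((Finset.univ.filter fun u : Fin 2 → K => M.mulVec u = N.mulVec u).card : ℝ) := by
  rw [Fintype.sum_prod_type, Finset.natCast_card_filter]
  refine Finset.sum_congr rfl fun u _ => ?_
  simp_rw [ite_mul, one_mul, zero_mul, Finset.sum_ite_eq, if_pos (Finset.mem_univ _)]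
  exact if_congr eq_comm rfl rfl

/-- Pure algebra: `Σ_{i,j} (Σ_p v i p · v j p)² = Σ_{p,q} (Σ_i v i p · v i q)²` (both sides equal
`Σ_{i,j,p,q} v i p · v j p · v i q · v j q`). -/
private theorem gl2Flat_trace_rank_frame_gram_swap {ι P : Type} [Fintype ι] [Fintype P]
    (v : ι → P → ℝ) :
    ∑ i, ∑ j, (∑ p, v i p * v j p) ^ 2 = ∑ p, ∑ q, (∑ i, v i p * v i q) ^ 2 := by
  simp_rw [sq, Fintype.sum_mul_sum]
  calc ∑ i, ∑ j, ∑ p, ∑ q, v i p * v j p * (v i q * v j q)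
      = ∑ i, ∑ p, ∑ q, ∑ j, v i p * v j p * (v i q * v j q) := by
        refine Finset.sum_congr rfl fun i _ => ?_
        rw [Finset.sum_comm]
        exact Finset.sum_congr rfl fun p _ => Finset.sum_comm
    _ = ∑ p, ∑ i, ∑ q, ∑ j, v i p * v j p * (v i q * v j q) := Finset.sum_comm
    _ = ∑ p, ∑ q, ∑ i, ∑ j, v i p * v i q * (v j p * v j q) := by
        refine Finset.sum_congr rfl fun p _ => ?_
        rw [Finset.sum_comm]
        exact Finset.sum_congr rfl fun q _ => Finset.sum_congr rfl fun i _ =>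
          Finset.sum_congr rfl fun j _ => by ring

/-- `Σ_{x y : ↥Γ} f x y = Σ_{x, y ∈ Γ} f x y` (subtype sums to `Finset` sums, twice). -/
private theorem gl2Flat_trace_rank_frame_sum_coe₂ {α : Type} (Γ : Finset α) (f : α → α → ℝ) :
    ∑ x : {x // x ∈ Γ}, ∑ y : {x // x ∈ Γ}, f x y = ∑ x ∈ Γ, ∑ y ∈ Γ, f x y := by
  rw [Finset.sum_coe_sort Γ (fun x => ∑ y : {x // x ∈ Γ}, f x y)]
  exact Finset.sum_congr rfl fun x _ => Finset.sum_coe_sort Γ (f x)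

/-- The Gram side: `Σ_{p,p'} ⟨c_p, c_{p'}⟩² = Σ_{x, y ∈ Γ} n(x, y)²` with
`n(x, y) = #{u : x u = y u}`. -/
private theorem gl2Flat_trace_rank_frame_gram_sq
    (Γ : Finset (Matrix.GeneralLinearGroup (Fin 2) K)) :
    ∑ p : (Fin 2 → K) × (Fin 2 → K), ∑ p' : (Fin 2 → K) × (Fin 2 → K),
        (∑ x : {x // x ∈ Γ},
          (if ((x : Matrix.GeneralLinearGroup (Fin 2) K) : Matrix (Fin 2) (Fin 2) K).mulVec p.1 = p.2
            then (1 : ℝ) else 0) *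
          (if ((x : Matrix.GeneralLinearGroup (Fin 2) K) : Matrix (Fin 2) (Fin 2) K).mulVec p'.1 =
              p'.2 then (1 : ℝ) else 0)) ^ 2 =
      ∑ x ∈ Γ, ∑ y ∈ Γ,
        ((Finset.univ.filter fun u : Fin 2 → K =>
          (x : Matrix (Fin 2) (Fin 2) K).mulVec u = (y : Matrix (Fin 2) (Fin 2) K).mulVec u).card :
            ℝ) ^ 2 := by
  rw [gl2Flat_trace_rank_frame_gram_swap (fun (p : (Fin 2 → K) × (Fin 2 → K))
    (x : {x // x ∈ Γ}) =>
      if ((x : Matrix.GeneralLinearGroup (Fin 2) K) : Matrix (Fin 2) (Fin 2) K).mulVec p.1 = p.2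
        then (1 : ℝ) else 0)]
  simp_rw [gl2Flat_trace_rank_frame_gram_entry]
  exact gl2Flat_trace_rank_frame_sum_coe₂ Γ fun x y =>
    ((Finset.univ.filter fun u : Fin 2 → K =>
      (x : Matrix (Fin 2) (Fin 2) K).mulVec u = (y : Matrix (Fin 2) (Fin 2) K).mulVec u).card : ℝ) ^ 2

/-- **Trace–rank inequality for the frame indicator vectors** (piece (a) of the flat-size lemma on
`GL₂(K)`): for `Γ ⊆ GL₂(K)`, with `ρ` the dimension of the real span of the indicator vectors
`c_(u,w) ∈ ℝ^Γ`, `c_(u,w)(x) = [x u = w]`, and `n(x, y) = #{u ∈ K² : x u = y u}`,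
`Q⁴ · |Γ|² ≤ ρ · Σ_{x, y ∈ Γ} n(x, y)²`. [folklore] -/
theorem gl2Flat_trace_rank_frame : ∀ {K : Type} [Field K] [Fintype K] [DecidableEq K] (Γ : Finset (Matrix.GeneralLinearGroup (Fin 2) K)), (Fintype.card K : ℝ) ^ 4 * (Γ.card : ℝ) ^ 2 ≤ (Module.finrank ℝ (Submodule.span ℝ (Set.range fun p : (Fin 2 → K) × (Fin 2 → K) => fun x : {x // x ∈ Γ} => if ((x : Matrix.GeneralLinearGroup (Fin 2) K) : Matrix (Fin 2) (Fin 2) K).mulVec p.1 = p.2 then (1 : ℝ) else 0)) : ℝ) * ∑ x ∈ Γ, ∑ y ∈ Γ, ((Finset.univ.filter fun u : Fin 2 → K => (x : Matrix (Fin 2) (Fin 2) K).mulVec u = (y : Matrix (Fin 2) (Fin 2) K).mulVec u).card : ℝ) ^ 2 := by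
  intro K _ _ _ Γ
  have h := sum_sq_sq_le_finrank_mul_sum_gram_sq
    (fun (p : (Fin 2 → K) × (Fin 2 → K)) (x : {x // x ∈ Γ}) =>
      if ((x : Matrix.GeneralLinearGroup (Fin 2) K) : Matrix (Fin 2) (Fin 2) K).mulVec p.1 = p.2
        then (1 : ℝ) else 0)
  rw [gl2Flat_trace_rank_frame_sum_sq, gl2Flat_trace_rank_frame_gram_sq] at h
  calc (Fintype.card K : ℝ) ^ 4 * (Γ.card : ℝ) ^ 2
      = ((Fintype.card K : ℝ) ^ 2 * Γ.card) ^ 2 := by ring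
    _ ≤ _ := h

end Summit.MatrixMultiplication.MatrixMultiplication.Theorems.GradedDesignFamily.Negative
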